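import Mathlib
import Summits.KontsevichZagierPeriods.Zeta5Search.CatalanQSum
import Summits.KontsevichZagierPeriods.Zeta5Search.CatalanQSumTwoAdicProof
import Summits.KontsevichZagierPeriods.Zeta5Search.Denom.CatalanBoxArithmetic
import Summits.KontsevichZagierPeriods.Zeta5Search.Denom.CatalanQBridge
import HarnessLib

/-!
# Catalan box family — PROOF of the bridge `catalanQ = QClosed` for ALL parameters, hence of `CatalanQSum.DyadicLaw`

HONEST FRAMING: systematic search; no irrationality claim unless certified.

Cell `pub-zeta5`, prover seat p3 (gen 2), for the fam-denom (D6, `CATK1.md`) and fam-catalan (`QSUM.md`) lanes.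
`theorem bridgeLaw_holds : BridgeLaw` discharges the `@[conjecture]` node of `Denom/CatalanQBridge.lean` (p238652): the two explicit
finite sums for the `G`-coefficient of the Catalan box — fam-catalan's terminating `₃F₂` evaluator `catalanQ` and fam-denom's regrouped
super-Catalan/Landau sum `QClosed` — agree at EVERY parameter set with `H ≤ K + L` (`catalanQ_eq_QClosed`; the other box inequalities are
not needed).  With the tree's `dyadicLaw_of_bridgeLaw` (fam-denom, from the general `theoremA_QClosed`) this closes fam-catalan's node
`CatalanQSum.DyadicLaw` (`dyadicLaw_holds`): the reduced denominator of `Q(H,J,K,L,M)` is a power of `2`; together with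
`CatalanQSum.twoAdicLaw_holds` (p238507) the denominator of `Q` is now EXACTLY known on the whole box, as a theorem.
Nothing here is a statement about Catalan's constant.

PROOF (a finite hypergeometric regrouping, made explicit).  Both sums are brought to the common normal form
`u_i = 8(−1)^{H+L} C(J,i) (½)_K g(H−L+i) · op(−(H+i),S)/(2^S S!) / (C−i)!` (`uTerm`; `g = gammaHalfRatio`, `op` = fam-denom's odd run,
`S = J+K−M`, `C = K+L−H`):
* Part A: the bricks `g(r+1)(r+½) = g(r)` (`gammaHalfRatio_succ`), `(2n)! = 4^n n! (½)_n` (`two_mul_factorial_eq_poch`), the odd-run shift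
  (`op_neg_succ`, from the tree's `op_shift`) and the base identity `op(−H,S) = 2^S(−1)^S(½)_H g(H−S)` (`op_neg_eq`);
* Part B: `u_0` is the prefactor of `catalanQ` (`uTerm_zero`) and `u_{i+1}/u_i` is EXACTLY the term ratio of
  `₃F₂(−J,−C,H+½;H−L+½,H−S+½;1)` (`uTerm_succ`), so prefactor × (`i`-th evaluator term) `= u_i` (`prefactor_mul_f32Aux_fst`);
* Part C: fam-denom's summand `qTerm i` is `u_i` on both of its branches — type A (`H−L+i ≤ 0`, super-Catalan) and type C
  (`1 ≤ H−L+i ≤ K`, Landau) — by unpacking `S(k,b)/4^{k+b} = (½)_k(½)_b/(k+b)!`, `Λ·4^a/4^k = (½)_k/((½)_a(k−a)!)`, `g(−b) = (−1)^b(½)_b`,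
  `g(a) = 1/(½)_a` and parity of the signs (`qTerm_eq_uTerm_of_nonpos/_of_pos`); beyond `i = C` it vanishes (`qTerm_eq_zero_of_lt`);
* Part D: both totals are `Σ_{i ≤ min(J,C)}` of the common terms (`catalanQ_eq_QClosed`).
-/

open Finset

namespace Summit.KontsevichZagierPeriods.Zeta5Search.Denom.CatalanBox

open Summit.KontsevichZagierPeriods.Zeta5Search.CatalanQSum
open Summit.KontsevichZagierPeriods.Zeta5Search.KernelKit

/-! ### Part A — the hypergeometric bricks: `(½)_n`, `g(r) = Γ(½)/Γ(r+½)`, the odd runs `op`, `(2n)!` -/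

/-- The functional equation of `g(r) = Γ(½)/Γ(r+½)`: `g(r+1)·(r+½) = g(r)` for every integer `r`. -/
theorem gammaHalfRatio_succ (r : ℤ) : gammaHalfRatio (r + 1) * ((r : ℚ) + 1 / 2) = gammaHalfRatio r := by
  unfold gammaHalfRatio
  rcases lt_trichotomy r (-1) with hr | rfl | hr
  · -- r ≤ -2 : both on the negative branch
    obtain ⟨m, rfl⟩ : ∃ m : ℕ, r = -((m : ℤ) + 2) := ⟨(-r - 2).toNat, by omega⟩
    rw [if_neg (by omega), if_neg (by omega),
      show (-(-((m : ℤ) + 2) + 1)).toNat = m + 1 by omega, show (-(-((m : ℤ) + 2))).toNat = m + 1 + 1 by omega]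
    simp only [poch, pow_succ]
    push_cast
    ring
  · -- r = -1
    norm_num [poch]
  · -- r ≥ 0 : both on the positive branch
    obtain ⟨m, rfl⟩ : ∃ m : ℕ, r = m := ⟨r.toNat, by omega⟩
    rw [if_pos (by omega), if_pos (by omega), show ((m : ℤ) + 1).toNat = m + 1 by omega, Int.toNat_natCast, poch]
    have hne : (1 / 2 : ℚ) + (m : ℕ) ≠ 0 := by positivity
    have hp : poch (1 / 2) m ≠ 0 := poch_oneHalf_ne_zero m
    push_cast
    field_simp
    ring

/-- `g(a) = 1/(½)_a` for `a ≥ 0`. -/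
theorem gammaHalfRatio_natCast (a : ℕ) : gammaHalfRatio (a : ℤ) = (poch (1 / 2) a)⁻¹ := by
  unfold gammaHalfRatio
  rw [if_pos (by omega), Int.toNat_natCast]

/-- `g(−b) = (−1)^b (½)_b` for `b ≥ 0`. -/
theorem gammaHalfRatio_neg_natCast (b : ℕ) : gammaHalfRatio (-(b : ℤ)) = (-1) ^ b * poch (1 / 2) b := by
  unfold gammaHalfRatio
  rcases Nat.eq_zero_or_pos b with rfl | hb
  · simp [poch]
  · rw [if_neg (by omega), show (-(-(b : ℤ))).toNat = b by omega]

/-- `(2n)! = 4^n · n! · (½)_n` in `ℚ`. -/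
theorem two_mul_factorial_eq_poch (n : ℕ) :
    (((2 * n).factorial : ℕ) : ℚ) = 4 ^ n * ((n.factorial : ℕ) : ℚ) * poch (1 / 2) n := by
  induction n with
  | zero => simp [poch]
  | succ n ih =>
    rw [show 2 * (n + 1) = (2 * n + 1) + 1 by ring, Nat.factorial_succ, Nat.factorial_succ (2 * n), Nat.factorial_succ n,
      poch]
    push_cast
    rw [ih]
    ring

/-- The shift of the odd run in its start parameter, solved for the LOWER start:
`op(c)·(2c+1+2s) = op(c+1)·(2c+1)`, as rationals with `c = −(H+i+1)`:
`op(−(H+i+1), S)·(2H+2i+1−2S) = op(−(H+i), S)·(2H+2i+1)`. -/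
theorem op_neg_succ (H i S : ℕ) :
    ((op (-((H : ℤ) + ((i + 1 : ℕ) : ℤ))) S : ℤ) : ℚ) * (2 * H + 2 * i + 1 - 2 * S)
      = ((op (-((H : ℤ) + (i : ℕ))) S : ℤ) : ℚ) * (2 * H + 2 * i + 1) := by
  have h := op_shift (-((H : ℤ) + ((i + 1 : ℕ) : ℤ))) S
  rw [show -((H : ℤ) + ((i + 1 : ℕ) : ℤ)) + 1 = -((H : ℤ) + (i : ℕ)) by push_cast; ring] at h
  generalize op (-((H : ℤ) + ((i + 1 : ℕ) : ℤ))) S = B at h ⊢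
  generalize op (-((H : ℤ) + (i : ℕ))) S = A at h ⊢
  have h' := congrArg (fun z : ℤ => (z : ℚ)) h
  push_cast at h' ⊢
  linear_combination h'

/-- The base identity: `op(−H, S) = ∏_{e<S}(2e+1−2H) = 2^S (−1)^S (½)_H g(H−S)`. -/
theorem op_neg_eq (H S : ℕ) :
    ((op (-(H : ℤ)) S : ℤ) : ℚ) = 2 ^ S * (-1) ^ S * poch (1 / 2) H * gammaHalfRatio ((H : ℤ) - S) := by
  induction S with
  | zero =>
    simp only [op, Int.cast_one, pow_zero, one_mul, CharP.cast_eq_zero, sub_zero]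
    rw [gammaHalfRatio_natCast, mul_inv_cancel₀ (poch_oneHalf_ne_zero H)]
  | succ S ih =>
    rw [op, Int.cast_mul, ih]
    have hg := gammaHalfRatio_succ ((H : ℤ) - (S + 1 : ℕ))
    rw [show (H : ℤ) - ((S + 1 : ℕ) : ℤ) + 1 = (H : ℤ) - (S : ℕ) by push_cast; ring] at hg
    rw [← hg]
    push_cast
    ring

/-! ### Part B — the common normal form `u_i` of the two sums and its first-order recurrence -/

/-- The common hypergeometric normal form of the `i`-th term of both sums:
`u_i = 8(−1)^{H+L} C(J,i) (½)_K g(H−L+i) · op(−(H+i),S)/(2^S S!) / (C−i)!`. -/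
def uTerm (H J K L S C i : ℕ) : ℚ :=
  8 * (-1) ^ (H + L) * (J.choose i : ℚ) * poch (1 / 2) K * gammaHalfRatio ((H : ℤ) - L + (i : ℕ))
    * (((op (-((H : ℤ) + (i : ℕ))) S : ℤ) : ℚ) / (2 ^ S * ((S.factorial : ℕ) : ℚ)))
    / (((C - i).factorial : ℕ) : ℚ)

/-- `u_0` is the prefactor of `catalanQ`. -/
theorem uTerm_zero (H J K L S C : ℕ) :
    uTerm H J K L S C 0 = 8 * (-1) ^ (H + L + S) * poch (1 / 2) H * poch (1 / 2) K
      * gammaHalfRatio ((H : ℤ) - L) * gammaHalfRatio ((H : ℤ) - S)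
      / (((S.factorial : ℕ) : ℚ) * ((C.factorial : ℕ) : ℚ)) := by
  unfold uTerm
  rw [Nat.choose_zero_right, Nat.cast_one, mul_one, Nat.sub_zero, Nat.cast_zero, add_zero, add_zero, op_neg_eq, pow_add]
  have h2 : (2 : ℚ) ^ S ≠ 0 := pow_ne_zero _ two_ne_zero
  have hS : ((S.factorial : ℕ) : ℚ) ≠ 0 := by positivity
  have hC : ((C.factorial : ℕ) : ℚ) ≠ 0 := by positivity
  field_simp
  ring

/-- The first-order recurrence of `u`: the term ratio of `₃F₂(−J, −C, H+½; H−L+½, H−S+½; 1)`. -/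
theorem uTerm_succ (H J K L S C i : ℕ) (hiJ : i + 1 ≤ J) (hiC : i + 1 ≤ C) :
    uTerm H J K L S C (i + 1) = uTerm H J K L S C i *
      ((((i : ℚ) - J) * ((i : ℚ) - C) * ((H : ℚ) + 1 / 2 + i))
        / (((i : ℚ) + 1) * ((H : ℚ) - L + 1 / 2 + i) * ((H : ℚ) - S + 1 / 2 + i))) := by
  -- the four component ratios
  have hc : (J.choose (i + 1) : ℚ) = (J.choose i : ℚ) * ((J : ℚ) - i) / ((i : ℚ) + 1) := by
    have h := Nat.choose_succ_right_eq J i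
    rw [eq_div_iff (by positivity)]
    have h' : ((J.choose (i + 1) * (i + 1) : ℕ) : ℚ) = ((J.choose i * (J - i) : ℕ) : ℚ) := by exact_mod_cast h
    push_cast [Nat.cast_sub (by omega : i ≤ J)] at h'
    linear_combination h'
  have hb1 : ((H : ℚ) - L + 1 / 2 + i) ≠ 0 := by
    rw [show ((H : ℚ) - L + 1 / 2 + i) = (((H : ℤ) - L + i : ℤ) : ℚ) + 1 / 2 by push_cast; ring]
    exact intCast_add_half_ne_zero _
  have hg : gammaHalfRatio ((H : ℤ) - L + ((i + 1 : ℕ) : ℤ))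
      = gammaHalfRatio ((H : ℤ) - L + (i : ℕ)) / ((H : ℚ) - L + 1 / 2 + i) := by
    rw [eq_div_iff hb1]
    have h := gammaHalfRatio_succ ((H : ℤ) - L + (i : ℕ))
    rw [show (H : ℤ) - L + (i : ℕ) + 1 = (H : ℤ) - L + ((i + 1 : ℕ) : ℤ) by push_cast; ring] at h
    rw [← h]
    push_cast
    ring
  have hodd : (2 * (H : ℚ) + 2 * i + 1 - 2 * S) ≠ 0 := by
    rw [show (2 * (H : ℚ) + 2 * i + 1 - 2 * S) = ((2 * ((H : ℤ) + i - S) + 1 : ℤ) : ℚ) by push_cast; ring]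
    exact_mod_cast (show (2 * ((H : ℤ) + i - S) + 1 : ℤ) ≠ 0 by omega)
  have ho : ((op (-((H : ℤ) + ((i + 1 : ℕ) : ℤ))) S : ℤ) : ℚ)
      = ((op (-((H : ℤ) + (i : ℕ))) S : ℤ) : ℚ) * (2 * H + 2 * i + 1) / (2 * H + 2 * i + 1 - 2 * S) := by
    rw [eq_div_iff hodd]
    exact op_neg_succ H i S
  have hCi : ((C : ℚ) - i) ≠ 0 := by
    rw [show ((C : ℚ) - i) = ((C - i : ℕ) : ℚ) by push_cast [Nat.cast_sub (by omega : i ≤ C)]; ring]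
    exact_mod_cast (show (C - i : ℕ) ≠ 0 by omega)
  have hf : (((C - (i + 1)).factorial : ℕ) : ℚ) = (((C - i).factorial : ℕ) : ℚ) / ((C : ℚ) - i) := by
    rw [eq_div_iff hCi, show C - i = (C - (i + 1)) + 1 by omega, Nat.factorial_succ]
    push_cast [Nat.cast_sub (by omega : i + 1 ≤ C)]
    ring
  have hb2 : ((H : ℚ) - S + 1 / 2 + i) ≠ 0 := by
    rw [show ((H : ℚ) - S + 1 / 2 + i) = (((H : ℤ) - S + i : ℤ) : ℚ) + 1 / 2 by push_cast; ring]
    exact intCast_add_half_ne_zero _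
  have hi1 : ((i : ℚ) + 1) ≠ 0 := by positivity
  have h2 : (2 : ℚ) ^ S ≠ 0 := pow_ne_zero _ two_ne_zero
  have hS : ((S.factorial : ℕ) : ℚ) ≠ 0 := by positivity
  have hfC : (((C - i).factorial : ℕ) : ℚ) ≠ 0 := by positivity
  unfold uTerm
  rw [hc, hg, ho, hf]
  field_simp
  ring

/-- `Pref · t_i = u_i`: the prefactor of `catalanQ` times the `i`-th term of the `₃F₂` evaluator is the normal form `u_i`
(`i ≤ min(J, C)`; induction on `i` with the common term ratio). -/
theorem prefactor_mul_f32Aux_fst (H J K L S C i : ℕ) (hi : i ≤ min J C) :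
    8 * (-1) ^ (H + L + S) * poch (1 / 2) H * poch (1 / 2) K * gammaHalfRatio ((H : ℤ) - L)
        * gammaHalfRatio ((H : ℤ) - S) / (((S.factorial : ℕ) : ℚ) * ((C.factorial : ℕ) : ℚ))
      * (f32Aux J C ((H : ℚ) + 1 / 2) ((H : ℚ) - L + 1 / 2) ((H : ℚ) - S + 1 / 2) i).1
      = uTerm H J K L S C i := by
  induction i with
  | zero =>
    rw [uTerm_zero]
    simp [f32Aux]
  | succ i ih =>
    have hiJ : i + 1 ≤ J := le_trans hi (min_le_left _ _)
    have hiC : i + 1 ≤ C := le_trans hi (min_le_right _ _)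
    rw [f32Aux_fst_succ, uTerm_succ H J K L S C i hiJ hiC, ← ih (by omega), mul_assoc]
    ring

/-! ### Part C — fam-denom's regrouped summand `qTerm` is the same normal form -/

/-- Parity transport of signs: `(−1)^m = (−1)^n` when `m + n` is even. -/
theorem neg_one_pow_eq_of_even_add {m n : ℕ} (h : Even (m + n)) : (-1 : ℚ) ^ m = (-1) ^ n := by
  have h1 : (-1 : ℚ) ^ (m + n) = 1 := h.neg_one_pow
  rw [pow_add] at h1
  have h2 : ((-1 : ℚ) ^ n) * ((-1 : ℚ) ^ n) = 1 := by
    rw [← pow_add, ← two_mul, pow_mul]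
    norm_num
  calc (-1 : ℚ) ^ m = (-1) ^ m * ((-1) ^ n * (-1) ^ n) := by rw [h2, mul_one]
    _ = ((-1) ^ m * (-1) ^ n) * (-1) ^ n := by ring
    _ = (-1) ^ n := by rw [h1, one_mul]

/-- Type-A terms (`α = H − L + i ≤ 0`, super-Catalan branch) equal `u_i`. -/
theorem qTerm_eq_uTerm_of_nonpos (H J K L M i : ℕ) (hα : (H : ℤ) - L + i ≤ 0) :
    qTerm H J K L M i = uTerm H J K L (J + K - M) (K + L - H) i := by
  obtain ⟨b, hb⟩ : ∃ b : ℕ, (b : ℤ) = (L : ℤ) - H - i := ⟨(L - H - i : ℕ), by omega⟩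
  have htoNat : (-((H : ℤ) - (L : ℤ) + (i : ℤ))).toNat = b := by omega
  have hsign : (-1 : ℚ) ^ i = (-1) ^ (H + L) * (-1) ^ b := by
    rw [← pow_add]
    exact neg_one_pow_eq_of_even_add ⟨L, by omega⟩
  unfold qTerm
  simp only [hα, if_true]
  rw [htoNat, binomF_eq, hsign]
  unfold F1 superCatalan uTerm
  rw [oddProd_eq_op, show -((H : ℤ) - (L : ℤ) + (i : ℤ)) - (L : ℤ) = -((H : ℤ) + (i : ℕ)) by ring,
    show (K + L - H - i : ℕ) = K + b by omega, show ((H : ℤ) - L + (i : ℕ)) = -(b : ℤ) by omega,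
    gammaHalfRatio_neg_natCast, two_mul_factorial_eq_poch K, two_mul_factorial_eq_poch b]
  have h1 : ((K.factorial : ℕ) : ℚ) ≠ 0 := by positivity
  have h2 : ((b.factorial : ℕ) : ℚ) ≠ 0 := by positivity
  have h3 : (((K + b).factorial : ℕ) : ℚ) ≠ 0 := by positivity
  have h4 : (((J + K - M).factorial : ℕ) : ℚ) ≠ 0 := by positivity
  have h5 : (2 : ℚ) ^ (J + K - M) ≠ 0 := pow_ne_zero _ two_ne_zero
  have h6 : (4 : ℚ) ^ (K + b) ≠ 0 := pow_ne_zero _ (by norm_num)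
  field_simp
  ring

/-- Type-C terms (`1 ≤ α = H − L + i ≤ K`, Landau branch) equal `u_i`. -/
theorem qTerm_eq_uTerm_of_pos (H J K L M i : ℕ) (hα : 0 < (H : ℤ) - L + i)
    (hαK : (H : ℤ) - L + i ≤ K) : qTerm H J K L M i = uTerm H J K L (J + K - M) (K + L - H) i := by
  obtain ⟨a, ha⟩ : ∃ a : ℕ, (a : ℤ) = (H : ℤ) - L + i := ⟨(H + i - L : ℕ), by omega⟩
  have htoNat : ((H : ℤ) - (L : ℤ) + (i : ℤ)).toNat = a := by omega
  obtain ⟨a', rfl⟩ : ∃ a', a = a' + 1 := ⟨a - 1, by omega⟩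
  have hsign : (-1 : ℚ) ^ (H + L) = (-1) ^ i * (-1) ^ (a' + 1) := by
    rw [← pow_add]
    exact neg_one_pow_eq_of_even_add ⟨H + i, by omega⟩
  have hnot : ¬ ((H : ℤ) - (L : ℤ) + (i : ℤ) ≤ 0) := by omega
  unfold qTerm
  simp only [hnot, hαK, if_false, if_true]
  rw [htoNat, binomF_eq, Nat.add_sub_cancel]
  unfold F1 landau uTerm
  rw [oddProd_eq_op, show -((H : ℤ) - (L : ℤ) + (i : ℤ)) - (L : ℤ) = -((H : ℤ) + (i : ℕ)) by ring,
    show (K + L - H - i : ℕ) = K - (a' + 1) by omega, show a' + 1 + (K - (a' + 1)) = K by omega,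
    show ((H : ℤ) - L + (i : ℕ)) = ((a' + 1 : ℕ) : ℤ) by omega, gammaHalfRatio_natCast,
    two_mul_factorial_eq_poch K, two_mul_factorial_eq_poch (a' + 1), hsign]
  have h1 : ((K.factorial : ℕ) : ℚ) ≠ 0 := by positivity
  have h2 : (((a' + 1).factorial : ℕ) : ℚ) ≠ 0 := by positivity
  have h3 : (((K - (a' + 1)).factorial : ℕ) : ℚ) ≠ 0 := by positivity
  have h4 : (((J + K - M).factorial : ℕ) : ℚ) ≠ 0 := by positivity
  have h5 : (2 : ℚ) ^ (J + K - M) ≠ 0 := pow_ne_zero _ two_ne_zero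
  have h6 : (4 : ℚ) ^ K ≠ 0 := pow_ne_zero _ (by norm_num)
  have h7 : poch (1 / 2) (a' + 1) ≠ 0 := poch_oneHalf_ne_zero _
  have h8 : (4 : ℚ) ^ (a' + 1) ≠ 0 := pow_ne_zero _ (by norm_num)
  field_simp
  ring

/-- Beyond `i = C = K + L − H` the regrouped summand vanishes (`α > K`). -/
theorem qTerm_eq_zero_of_lt (H J K L M i : ℕ) (hH : H ≤ K + L) (hi : K + L - H < i) : qTerm H J K L M i = 0 := by
  unfold qTerm
  have h1 : ¬ (H : ℤ) - (L : ℤ) + (i : ℤ) ≤ 0 := by omega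
  have h2 : ¬ (H : ℤ) - (L : ℤ) + (i : ℤ) ≤ (K : ℤ) := by omega
  simp [h1, h2]

/-- On the summation range both summands agree. -/
theorem qTerm_eq_uTerm (H J K L M i : ℕ) (hH : H ≤ K + L) (hi : i ≤ K + L - H) :
    qTerm H J K L M i = uTerm H J K L (J + K - M) (K + L - H) i := by
  rcases le_or_gt ((H : ℤ) - L + i) 0 with h | h
  · exact qTerm_eq_uTerm_of_nonpos H J K L M i h
  · exact qTerm_eq_uTerm_of_pos H J K L M i h (by omega)

/-! ### Part D — the sums -/

/-- `qSum … n = Σ_{i ≤ n} qTerm … i`. -/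
theorem qSum_eq_sum (H J K L M n : ℕ) : qSum H J K L M n = ∑ i ∈ range (n + 1), qTerm H J K L M i := by
  induction n with
  | zero => simp [qSum]
  | succ n ih =>
    rw [qSum, ih]
    exact (Finset.sum_range_succ _ (n + 1)).symm

/-- The partial sum of the `₃F₂` evaluator is the sum of its terms. -/
theorem f32Aux_snd_eq_sum (J C : ℕ) (a b₁ b₂ : ℚ) (n : ℕ) :
    (f32Aux J C a b₁ b₂ n).2 = ∑ i ∈ range (n + 1), (f32Aux J C a b₁ b₂ i).1 := by
  rw [f32Aux_snd_eq, Finset.sum_range_succ', add_comm]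
  simp [f32Aux]

/-- **THE BRIDGE**: `catalanQ = QClosed` at every parameter set with `H ≤ K + L` (the other box inequalities are not needed). -/
theorem catalanQ_eq_QClosed (H J K L M : ℕ) (hH : H ≤ K + L) : catalanQ H J K L M = QClosed H J K L M := by
  have eq1 : catalanQ H J K L M
      = ∑ i ∈ range (min J (K + L - H) + 1), uTerm H J K L (J + K - M) (K + L - H) i := by
    unfold catalanQ f32
    dsimp only
    rw [f32Aux_snd_eq_sum, Finset.mul_sum]
    refine Finset.sum_congr rfl fun i hi => ?_
    exact prefactor_mul_f32Aux_fst H J K L (J + K - M) (K + L - H) i (by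
      have := Finset.mem_range.1 hi; omega)
  have eq2 : QClosed H J K L M = ∑ i ∈ range (min J (K + L - H) + 1), qTerm H J K L M i := by
    unfold QClosed
    rw [qSum_eq_sum]
    symm
    refine Finset.sum_subset (fun i hi => ?_) (fun i hi hni => ?_)
    · have := Finset.mem_range.1 hi
      exact Finset.mem_range.2 (by omega)
    · have h1 := Finset.mem_range.1 hi
      rw [Finset.mem_range] at hni
      exact qTerm_eq_zero_of_lt H J K L M i hH (by omega)
  rw [eq1, eq2]
  refine Finset.sum_congr rfl fun i hi => ?_
  have := Finset.mem_range.1 hi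
  exact (qTerm_eq_uTerm H J K L M i hH (by omega)).symm

/-! ### The two conjecture nodes -/

/-- **`BridgeLaw` holds**: `catalanQ = QClosed` on the whole box (discharges the node of `Denom/CatalanQBridge.lean`). -/
theorem bridgeLaw_holds : BridgeLaw :=
  fun H J K L M hH _ _ _ _ => catalanQ_eq_QClosed H J K L M hH

/-- **fam-catalan's `DyadicLaw` holds**: the reduced denominator of `catalanQ H J K L M` is a power of `2` on the whole box
(bridge + fam-denom's general `theoremA_QClosed`, via `dyadicLaw_of_bridgeLaw`). -/
theorem dyadicLaw_holds : DyadicLaw :=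
  dyadicLaw_of_bridgeLaw bridgeLaw_holds

end Summit.KontsevichZagierPeriods.Zeta5Search.Denom.CatalanBox
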